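import Summits.FinalStateConjecture.FinalStateConjecture.Statement

/-!
# Solo (blind) — the assembly layer of the final state conjecture as typed

Structural facts about the summit statement `FinalStateConjecture`
(`Summits/FinalStateConjecture/FinalStateConjecture/Statement.lean`), all proved, no named facts
consumed:

* `SoloBlindSettles X D` — the **pointwise final-state property** `P_X(D)` whose tame
  Christodoulou-genericity inside `admissibleVacuumData X` the summit asserts
  (`soloBlind_statement_iff`, by `Iff.rfl`).
* **Monotonicity.** Tame relative codimension is antitone in the exceptional set
  (`soloBlind_hasTameCodimAtLeastIn_anti`) and tame Christodoulou-genericity is monotone in the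
  property along implications valid on the admissible class
  (`soloBlind_isTameChristodoulouGeneric_mono`). NOTE (documented, not formalised): the notion is
  **not** closed under conjunction of properties — through an exceptional datum of `P ∧ Q` the
  escaping curve for `P` may run inside the exceptional set of `Q` — so the summit cannot be
  assembled from separately generic statements (e.g. "weak cosmic censorship is generic" and
  "settling to Kerr is generic"); any proof must produce ONE escaping family per exceptional datum.
* **Dichotomy architecture** (`soloBlind_isTameChristodoulouGeneric_iff_dichotomy`,
  `soloBlind_of_dichotomy`): the summit is equivalent to the existence, for every `Σ`, of an
  exceptional class `E_Σ` with (i) the pointwise theorem `∀ D ∈ 𝓓_Σ ∖ E_Σ, P_Σ(D)` and (ii) the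
  instability theorem `HasTameCodimAtLeastIn 𝓓_Σ (𝓓_Σ ∩ E_Σ) 1`. In particular the pointwise
  property for all admissible data implies the summit (`soloBlind_of_forall`).
* **Necessary consequences**: the summit implies the tame-generic form of weak cosmic censorship
  with MGHD existence (`soloBlind_weakCosmicCensorship_of_statement`) and tame-generic existence of
  a maximal development (`soloBlind_mghdGeneric_of_statement`).

References: D. Christodoulou, *On the global initial value problem and the issue of
singularities*, CQG 16 (1999) A23–A35, p. A24 (genericity as positive codimension of the
exceptional set); *The instability of naked singularities…*, Ann. Math. 149 (1999) 183–217, p. 187.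
-/

noncomputable section

set_option linter.dupNamespace false

open Literature.Geometry.Lorentzian Set
open scoped Manifold ContDiff

namespace Summit.FinalStateConjecture.FinalStateConjecture.Theorems

/-! ### Genericity: monotonicity and the dichotomy form -/

section Genericity

variable {X : Type*} [TopologicalSpace X] [ChartedSpace E3 X] [IsManifold (𝓡 3) ∞ X]

/-- **Tame relative codimension is antitone in the exceptional set**: a subset of a set of tame
codimension `≥ m` inside `𝓓` has tame codimension `≥ m` inside `𝓓` (the same escaping family
works). Christodoulou, CQG 16 (1999), p. A24. -/
theorem soloBlind_hasTameCodimAtLeastIn_anti {𝓓 𝓔 𝓔' : Set (InitialDataSet (𝓡 3) X)} {m : ℕ}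
    (h : InitialDataSet.HasTameCodimAtLeastIn 𝓓 𝓔 m) (h𝓔 : 𝓔' ⊆ 𝓔) :
    InitialDataSet.HasTameCodimAtLeastIn 𝓓 𝓔' m := by
  intro d hd
  obtain ⟨e, F, hF, himm, h0, hinj, hD, hE⟩ := h d (h𝓔 hd)
  exact ⟨e, F, hF, himm, h0, hinj, hD, fun c hc hc' ↦ hE c hc (h𝓔 hc')⟩

/-- **Tame Christodoulou-genericity is monotone in the property**: if `P → Q` on the admissible
class `𝓓` and `P` is tame-generic with codimension `m`, so is `Q`. Christodoulou, CQG 16 (1999),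
p. A24. -/
theorem soloBlind_isTameChristodoulouGeneric_mono {𝓓 : Set (InitialDataSet (𝓡 3) X)}
    {P Q : InitialDataSet (𝓡 3) X → Prop} {m : ℕ} (hPQ : ∀ d ∈ 𝓓, P d → Q d)
    (h : InitialDataSet.IsTameChristodoulouGeneric 𝓓 P m) :
    InitialDataSet.IsTameChristodoulouGeneric 𝓓 Q m :=
  soloBlind_hasTameCodimAtLeastIn_anti h fun d hd ↦ ⟨hd.1, fun hP ↦ hd.2 (hPQ d hd.1 hP)⟩

/-- **Dichotomy assembly**: if every admissible datum outside an exceptional class `E` has the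
property `P`, and `𝓓 ∩ E` has tame codimension `≥ m` inside `𝓓`, then `P` is tame-generic with
codimension `m`. Christodoulou, CQG 16 (1999), p. A24; Ann. Math. 149 (1999), p. 187 (the shape
of the proof of the instability of naked singularities: exceptional set `E`, escaping lines). -/
theorem soloBlind_isTameChristodoulouGeneric_of_dichotomy {𝓓 E : Set (InitialDataSet (𝓡 3) X)}
    {P : InitialDataSet (𝓡 3) X → Prop} {m : ℕ} (hdich : ∀ d ∈ 𝓓, d ∉ E → P d)
    (hE : InitialDataSet.HasTameCodimAtLeastIn 𝓓 (𝓓 ∩ E) m) :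
    InitialDataSet.IsTameChristodoulouGeneric 𝓓 P m :=
  soloBlind_hasTameCodimAtLeastIn_anti hE fun d hd ↦
    ⟨hd.1, Classical.by_contradiction fun hdE ↦ hd.2 (hdich d hd.1 hdE)⟩

/-- **The dichotomy form is equivalent to genericity** (take `E` = the exceptional set). -/
theorem soloBlind_isTameChristodoulouGeneric_iff_dichotomy {𝓓 : Set (InitialDataSet (𝓡 3) X)}
    {P : InitialDataSet (𝓡 3) X → Prop} {m : ℕ} :
    InitialDataSet.IsTameChristodoulouGeneric 𝓓 P m ↔
      ∃ E : Set (InitialDataSet (𝓡 3) X),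
        (∀ d ∈ 𝓓, d ∉ E → P d) ∧ InitialDataSet.HasTameCodimAtLeastIn 𝓓 (𝓓 ∩ E) m := by
  constructor
  · intro h
    refine ⟨{d | ¬ P d}, fun d _ hd ↦ Classical.not_not.1 hd, ?_⟩
    exact h
  · rintro ⟨E, hdich, hE⟩
    exact soloBlind_isTameChristodoulouGeneric_of_dichotomy hdich hE

end Genericity

/-! ### The summit: pointwise property, assembly, necessary consequences -/

section Summit

/-- **The pointwise final-state property `P_Σ(D)`** of a datum `D` on `Σ = X`, verbatim the
property whose genericity `FinalStateConjecture` asserts: `D` has a maximal globally hyperbolic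
vacuum development, and every MGHD of `D` has complete future null infinity and settles down on
the exterior `O = J⁺(Σ) ∩ I⁻(charted)` to finitely many subextremal Kerr black holes plus
radiation, with the rays, exhaustion and orientation clauses of the statement. Dafermos–Luk
arXiv:1710.01722, Conjecture 1; Christodoulou, CQG 16 (1999), pp. A24–A27. -/
def SoloBlindSettles (X : Type) [TopologicalSpace X] [ChartedSpace E3 X] [IsManifold (𝓡 3) ∞ X]
    [T2Space X] [SecondCountableTopology X] [ConnectedSpace X] (D : InitialDataSet (𝓡 3) X) :
    Prop :=
  (∃ 𝒟 : VacuumCauchyDevelopment D, 𝒟.IsMaximal) ∧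
    ∀ 𝒟 : VacuumCauchyDevelopment D, 𝒟.IsMaximal →
      Summit.FinalStateConjecture.HasCompleteNullInfinity 𝒟.toCauchyDevelopment ∧
        ∃ (O : Set 𝒟.carrier) (d : FinalStateDecomposition 𝒟.toSpacetime O 2),
          (∀ i, Kerr.IsSubextremal (d.mass i) (d.spin i)) ∧
            O = Summit.FinalStateConjecture.exteriorOf 𝒟.toCauchyDevelopment d.charted ∧
              Summit.FinalStateConjecture.RaysStayInClosure 𝒟.toCauchyDevelopment O ∧
                Summit.FinalStateConjecture.HasExhaustiveCharts d ∧
                  Summit.FinalStateConjecture.IsFutureOriented d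

/-- **The summit is the tame genericity of `SoloBlindSettles`** (definitional unfolding). -/
theorem soloBlind_statement_iff :
    FinalStateConjecture ↔
      ∀ (X : Type) [TopologicalSpace X] [ChartedSpace E3 X] [IsManifold (𝓡 3) ∞ X] [T2Space X]
        [SecondCountableTopology X] [ConnectedSpace X],
        InitialDataSet.IsTameChristodoulouGeneric (admissibleVacuumData X)
          (SoloBlindSettles X) 1 :=
  Iff.rfl

/-- **Pointwise implies generic**: if every admissible datum on every `Σ` settles, the final state
conjecture holds (empty exceptional set). -/
theorem soloBlind_of_forall
    (h : ∀ (X : Type) [TopologicalSpace X] [ChartedSpace E3 X] [IsManifold (𝓡 3) ∞ X]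
      [T2Space X] [SecondCountableTopology X] [ConnectedSpace X],
      ∀ D ∈ admissibleVacuumData X, SoloBlindSettles X D) :
    FinalStateConjecture :=
  fun X _ _ _ _ _ _ ↦ InitialDataSet.isTameChristodoulouGeneric_of_forall (h X) 1

/-- **Dichotomy architecture of any proof**: an exceptional class `E_Σ ⊆` data on each `Σ`, the
pointwise theorem off `E_Σ`, and the Christodoulou instability theorem for `𝓓_Σ ∩ E_Σ` (tame
codimension `≥ 1`) together give the summit. Christodoulou, Ann. Math. 149 (1999), p. 187. -/
theorem soloBlind_of_dichotomy
    (E : ∀ (X : Type) [TopologicalSpace X] [ChartedSpace E3 X] [IsManifold (𝓡 3) ∞ X],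
      Set (InitialDataSet (𝓡 3) X))
    (hdich : ∀ (X : Type) [TopologicalSpace X] [ChartedSpace E3 X] [IsManifold (𝓡 3) ∞ X]
      [T2Space X] [SecondCountableTopology X] [ConnectedSpace X],
      ∀ D ∈ admissibleVacuumData X, D ∉ E X → SoloBlindSettles X D)
    (hcodim : ∀ (X : Type) [TopologicalSpace X] [ChartedSpace E3 X] [IsManifold (𝓡 3) ∞ X]
      [T2Space X] [SecondCountableTopology X] [ConnectedSpace X],
      InitialDataSet.HasTameCodimAtLeastIn (admissibleVacuumData X)
        (admissibleVacuumData X ∩ E X) 1) :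
    FinalStateConjecture :=
  fun X _ _ _ _ _ _ ↦ soloBlind_isTameChristodoulouGeneric_of_dichotomy (hdich X) (hcodim X)

/-- **Conversely the summit yields the dichotomy data** on every `Σ` (the exceptional set itself). -/
theorem soloBlind_dichotomy_of_statement (h : FinalStateConjecture) (X : Type) [TopologicalSpace X]
    [ChartedSpace E3 X] [IsManifold (𝓡 3) ∞ X] [T2Space X] [SecondCountableTopology X]
    [ConnectedSpace X] :
    ∃ E : Set (InitialDataSet (𝓡 3) X),
      (∀ D ∈ admissibleVacuumData X, D ∉ E → SoloBlindSettles X D) ∧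
        InitialDataSet.HasTameCodimAtLeastIn (admissibleVacuumData X)
          (admissibleVacuumData X ∩ E) 1 :=
  soloBlind_isTameChristodoulouGeneric_iff_dichotomy.1 (h X)

/-- **Necessary consequence 1 — tame-generic weak cosmic censorship (with MGHD existence)**: the
final state conjecture implies that, for tame-generic admissible data, an MGHD exists and every
MGHD has complete future null infinity in Christodoulou's sojourn sense. Christodoulou, CQG 16
(1999), p. A27 (weak cosmic censorship as generic completeness of `𝓘⁺`). -/
theorem soloBlind_weakCosmicCensorship_of_statement (h : FinalStateConjecture) (X : Type)
    [TopologicalSpace X] [ChartedSpace E3 X] [IsManifold (𝓡 3) ∞ X] [T2Space X]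
    [SecondCountableTopology X] [ConnectedSpace X] :
    InitialDataSet.IsTameChristodoulouGeneric (admissibleVacuumData X)
      (fun D ↦ (∃ 𝒟 : VacuumCauchyDevelopment D, 𝒟.IsMaximal) ∧
        ∀ 𝒟 : VacuumCauchyDevelopment D, 𝒟.IsMaximal →
          Summit.FinalStateConjecture.HasCompleteNullInfinity 𝒟.toCauchyDevelopment) 1 :=
  soloBlind_isTameChristodoulouGeneric_mono
    (fun _ _ hP ↦ ⟨hP.1, fun 𝒟 h𝒟 ↦ (hP.2 𝒟 h𝒟).1⟩) (h X)

/-- **Necessary consequence 2 — tame-generic existence of a maximal development.** (The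
Choquet-Bruhat–Geroch theorem gives this for ALL admissible data; it is not yet a theorem of the
tree, and the summit only needs — and yields — the generic form.) Choquet-Bruhat–Geroch, CMP 14
(1969), Thm. 3. -/
theorem soloBlind_mghdGeneric_of_statement (h : FinalStateConjecture) (X : Type)
    [TopologicalSpace X] [ChartedSpace E3 X] [IsManifold (𝓡 3) ∞ X] [T2Space X]
    [SecondCountableTopology X] [ConnectedSpace X] :
    InitialDataSet.IsTameChristodoulouGeneric (admissibleVacuumData X)
      (fun D ↦ ∃ 𝒟 : VacuumCauchyDevelopment D, 𝒟.IsMaximal) 1 :=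
  soloBlind_isTameChristodoulouGeneric_mono (fun _ _ hP ↦ hP.1) (h X)

end Summit

end Summit.FinalStateConjecture.FinalStateConjecture.Theorems

end
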